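import Summits.KontsevichZagierPeriods.KontsevichZagierPeriods.Theses.DimensionBudget
import Summits.KontsevichZagierPeriods.KontsevichZagierPeriods.Theorems.LiftingCriteriaCubeNashNormalFormDimLeOne

/-!
# Line `tame-cell-atlas` for crux `CubeNashNormalForm` (shared item stmt-KontsevichZagierPeriods-3574),
# piece 1 of the split of `DimensionBudget.BudgetThesis` (stmt-KontsevichZagierPeriods-3748)

Skeleton (birth certificate BC3) over the LANDED reduction
`LiftingCriteria.CubeNashNormalFormDimLeOne.cubeNashNormalForm_of_volume_three` (dimensions `≤ 2` of the
cube–Nash normal form are in the tree; what remains is the normal form of BOUNDED volumes `∫_S 1`,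
`S ⊆ ℝ^{m+3}`). The remaining hypothesis is cut along the only natural seam:

* `stub_tameCellAtlas` — REAL ALGEBRAIC GEOMETRY, no calculus of moves (hardest, XL): a bounded
  `ℚ`-semialgebraic `S ⊆ ℝ^{m+3}` is, up to a Lebesgue-null set, the disjoint union of finitely many
  images of the OPEN unit cube under `ℚ`-semialgebraic maps that are injective and differentiable on the
  open cube and whose Jacobians `|det Φ'|` agree there with functions `g` that are `ℚ`-semialgebraic and
  real-analytic on a neighbourhood of the CLOSED cube (they may vanish on its boundary). This is embedded
  resolution / rectilinearisation in the Nash category (Hironaka 1964, 1973; Bierstone–Milman 1988, §4)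
  read chart by chart: resolve `∂S` to normal crossings by a proper birational Nash map `π`, take cube
  charts adapted to the divisor, restrict `π` to the open cubes (injective off the exceptional divisor,
  which is a union of faces).
* `stub_atlasToNormalForm` — CALCULUS BOOKKEEPING (M): such an atlas turns `[∫_S 1]` into the
  cube–Nash normal form: one change-of-variables move per chart (`[(0,1)^{m+3}, g] − [Φ '' cube, 1]`),
  domain additivity over the disjoint pieces and the null remainder (null domains are relations), and
  closing each open cube to the closed cube across its null boundary.

Composition `CubeNashNormalForm_of` feeds the two stubs into the landed reduction and concludes the route
decl of DimensionBudget BY NAME (definitionally the LiftingCriteria decl).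
-/

-- single-conjunct summit: Sub = Summit (CONVENTIONS §2)
set_option linter.dupNamespace false

open Set MeasureTheory
open Literature.ModelTheory.ExponentialFields (IsSemialgebraic)
open Literature.NumberTheory.Transcendental
open Literature.NumberTheory.Transcendental.KZ

namespace Summit.KontsevichZagierPeriods.KontsevichZagierPeriods.Cruxes.CubeNashNormalForm.TameCellAtlas

/-- **S1 `stub_tameCellAtlas` (rectilinearisation of bounded semialgebraic sets; hardest stub, XL).**
Every bounded `ℚ`-semialgebraic `S ⊆ ℝ^{m+3}` is covered up to a null set by finitely many pairwise
disjoint images `Φ i '' (0,1)^{m+3}` of the open unit cube under `ℚ`-semialgebraic maps `Φ i`, injective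
and differentiable on the open cube, with `|det (Φ' i x)| = g i x` there for functions `g i` that are
`ℚ`-semialgebraic and real-analytic on an open neighbourhood `U i` of the closed cube.
[Hironaka 1964; Bierstone–Milman 1988, §4 (rectilinearisation / uniformization); Bochnak–Coste–Roy 1998, §9] -/
theorem stub_tameCellAtlas : ∀ (m : ℕ) (S : Set (Fin (m + 3) → ℝ)), IsSemialgebraic ℚ S →
    Bornology.IsBounded S →
    ∃ (N : ℕ) (Φ : Fin N → (Fin (m + 3) → ℝ) → (Fin (m + 3) → ℝ))
      (Φ' : Fin N → (Fin (m + 3) → ℝ) → ((Fin (m + 3) → ℝ) →L[ℝ] (Fin (m + 3) → ℝ)))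
      (g : Fin N → (Fin (m + 3) → ℝ) → ℝ) (U : Fin N → Set (Fin (m + 3) → ℝ)),
      (∀ i, IsSemialgebraicMapOn ℚ {z : Fin (m + 3) → ℝ | ∀ l, 0 < z l ∧ z l < 1} (Φ i) ∧
        (∀ x ∈ {z : Fin (m + 3) → ℝ | ∀ l, 0 < z l ∧ z l < 1},
          HasFDerivWithinAt (Φ i) (Φ' i x) {z : Fin (m + 3) → ℝ | ∀ l, 0 < z l ∧ z l < 1} x) ∧
        Set.InjOn (Φ i) {z : Fin (m + 3) → ℝ | ∀ l, 0 < z l ∧ z l < 1} ∧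
        Φ i '' {z : Fin (m + 3) → ℝ | ∀ l, 0 < z l ∧ z l < 1} ⊆ S ∧
        IsOpen (U i) ∧ Set.pi Set.univ (fun _ : Fin (m + 3) => Set.Icc (0:ℝ) 1) ⊆ U i ∧
        IsSemialgebraicFunOn ℚ (U i) (g i) ∧ AnalyticOnNhd ℝ (g i) (U i) ∧
        (∀ x ∈ {z : Fin (m + 3) → ℝ | ∀ l, 0 < z l ∧ z l < 1}, |(Φ' i x).det| = g i x)) ∧
      (∀ i j, i ≠ j → Disjoint (Φ i '' {z : Fin (m + 3) → ℝ | ∀ l, 0 < z l ∧ z l < 1})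
        (Φ j '' {z : Fin (m + 3) → ℝ | ∀ l, 0 < z l ∧ z l < 1})) ∧
      volume (S \ ⋃ i, Φ i '' {z : Fin (m + 3) → ℝ | ∀ l, 0 < z l ∧ z l < 1}) = 0 := by
  sorry

/-- **S2 `stub_atlasToNormalForm` (from an atlas to the cube–Nash normal form of a bounded volume; size M).**
Given a bounded integrand-`1` representation `K = ∫_S 1` of dimension `m + 3` and a tame cell atlas of
`S` as in `stub_tameCellAtlas`, `[K]` is, modulo `KZ.relations`, a `ℤ`-combination of cube–Nash
representations: per chart one change-of-variables move `[(0,1)^{m+3}, g i] − [Φ i '' cube, 1]`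
(rule (2)), domain additivity (rule (1)) over the disjoint images and the null remainder (a null domain is a
relation), and one domain-additivity move closing each open cube to `[0,1]^{m+3}` across its null boundary.
[Kontsevich–Zagier 2001, §1.2 rules (1), (2)] -/
theorem stub_atlasToNormalForm : ∀ (m : ℕ) (K : IntegralRep (m + 3)), Bornology.IsBounded K.domain →
    (∀ x ∈ K.domain, K.integrand x = 1) →
    ∀ (N : ℕ) (Φ : Fin N → (Fin (m + 3) → ℝ) → (Fin (m + 3) → ℝ))
      (Φ' : Fin N → (Fin (m + 3) → ℝ) → ((Fin (m + 3) → ℝ) →L[ℝ] (Fin (m + 3) → ℝ)))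
      (g : Fin N → (Fin (m + 3) → ℝ) → ℝ) (U : Fin N → Set (Fin (m + 3) → ℝ)),
      (∀ i, IsSemialgebraicMapOn ℚ {z : Fin (m + 3) → ℝ | ∀ l, 0 < z l ∧ z l < 1} (Φ i) ∧
        (∀ x ∈ {z : Fin (m + 3) → ℝ | ∀ l, 0 < z l ∧ z l < 1},
          HasFDerivWithinAt (Φ i) (Φ' i x) {z : Fin (m + 3) → ℝ | ∀ l, 0 < z l ∧ z l < 1} x) ∧
        Set.InjOn (Φ i) {z : Fin (m + 3) → ℝ | ∀ l, 0 < z l ∧ z l < 1} ∧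
        Φ i '' {z : Fin (m + 3) → ℝ | ∀ l, 0 < z l ∧ z l < 1} ⊆ K.domain ∧
        IsOpen (U i) ∧ Set.pi Set.univ (fun _ : Fin (m + 3) => Set.Icc (0:ℝ) 1) ⊆ U i ∧
        IsSemialgebraicFunOn ℚ (U i) (g i) ∧ AnalyticOnNhd ℝ (g i) (U i) ∧
        (∀ x ∈ {z : Fin (m + 3) → ℝ | ∀ l, 0 < z l ∧ z l < 1}, |(Φ' i x).det| = g i x)) →
      (∀ i j, i ≠ j → Disjoint (Φ i '' {z : Fin (m + 3) → ℝ | ∀ l, 0 < z l ∧ z l < 1})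
        (Φ j '' {z : Fin (m + 3) → ℝ | ∀ l, 0 < z l ∧ z l < 1})) →
      volume (K.domain \ ⋃ i, Φ i '' {z : Fin (m + 3) → ℝ | ∀ l, 0 < z l ∧ z l < 1}) = 0 →
    ∃ (S : ℕ) (n : Fin S → ℕ) (g' : (i : Fin S) → (Fin (n i) → ℝ) → ℝ)
      (U' : (i : Fin S) → Set (Fin (n i) → ℝ)) (ε : Fin S → ℤ) (s : (i : Fin S) → IntegralRep (n i)),
      (∀ i, IsOpen (U' i) ∧ Set.pi Set.univ (fun _ : Fin (n i) => Set.Icc (0:ℝ) 1) ⊆ (U' i) ∧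
        IsSemialgebraicFunOn ℚ (U' i) (g' i) ∧ AnalyticOnNhd ℝ (g' i) (U' i)) ∧
      (∀ i, (s i).domain = Set.pi Set.univ (fun _ : Fin (n i) => Set.Icc (0:ℝ) 1) ∧
        ∀ z ∈ Set.pi Set.univ (fun _ : Fin (n i) => Set.Icc (0:ℝ) 1), (s i).integrand z = g' i z) ∧
      of K - ∑ i, ε i • of (s i) ∈ relations := by
  sorry

/-- **Composition**: the two stubs discharge the hypothesis of the landed reduction
`cubeNashNormalForm_of_volume_three` (dimensions `≤ 2` are in the tree), giving the shared crux
`CubeNashNormalForm` (item stmt-KontsevichZagierPeriods-3574) BY NAME — its home decl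
`LiftingCriteria.CubeNashNormalForm`; the DimensionBudget route decl of the same item is definitionally equal
(`DimensionBudget.CubeNashNormalForm`, rev 3 of that route file). [Kontsevich–Zagier 2001, §1.2; Viu-Sos 2021, Thm. 1.1] -/
theorem CubeNashNormalForm_of_stubs :
    (∀ (m : ℕ) (S : Set (Fin (m + 3) → ℝ)), IsSemialgebraic ℚ S → Bornology.IsBounded S →
      ∃ (N : ℕ) (Φ : Fin N → (Fin (m + 3) → ℝ) → (Fin (m + 3) → ℝ))
        (Φ' : Fin N → (Fin (m + 3) → ℝ) → ((Fin (m + 3) → ℝ) →L[ℝ] (Fin (m + 3) → ℝ)))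
        (g : Fin N → (Fin (m + 3) → ℝ) → ℝ) (U : Fin N → Set (Fin (m + 3) → ℝ)),
        (∀ i, IsSemialgebraicMapOn ℚ {z : Fin (m + 3) → ℝ | ∀ l, 0 < z l ∧ z l < 1} (Φ i) ∧
          (∀ x ∈ {z : Fin (m + 3) → ℝ | ∀ l, 0 < z l ∧ z l < 1},
            HasFDerivWithinAt (Φ i) (Φ' i x) {z : Fin (m + 3) → ℝ | ∀ l, 0 < z l ∧ z l < 1} x) ∧
          Set.InjOn (Φ i) {z : Fin (m + 3) → ℝ | ∀ l, 0 < z l ∧ z l < 1} ∧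
          Φ i '' {z : Fin (m + 3) → ℝ | ∀ l, 0 < z l ∧ z l < 1} ⊆ S ∧
          IsOpen (U i) ∧ Set.pi Set.univ (fun _ : Fin (m + 3) => Set.Icc (0:ℝ) 1) ⊆ U i ∧
          IsSemialgebraicFunOn ℚ (U i) (g i) ∧ AnalyticOnNhd ℝ (g i) (U i) ∧
          (∀ x ∈ {z : Fin (m + 3) → ℝ | ∀ l, 0 < z l ∧ z l < 1}, |(Φ' i x).det| = g i x)) ∧
        (∀ i j, i ≠ j → Disjoint (Φ i '' {z : Fin (m + 3) → ℝ | ∀ l, 0 < z l ∧ z l < 1})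
          (Φ j '' {z : Fin (m + 3) → ℝ | ∀ l, 0 < z l ∧ z l < 1})) ∧
        volume (S \ ⋃ i, Φ i '' {z : Fin (m + 3) → ℝ | ∀ l, 0 < z l ∧ z l < 1}) = 0) →
    (∀ (m : ℕ) (K : IntegralRep (m + 3)), Bornology.IsBounded K.domain →
      (∀ x ∈ K.domain, K.integrand x = 1) →
      ∀ (N : ℕ) (Φ : Fin N → (Fin (m + 3) → ℝ) → (Fin (m + 3) → ℝ))
        (Φ' : Fin N → (Fin (m + 3) → ℝ) → ((Fin (m + 3) → ℝ) →L[ℝ] (Fin (m + 3) → ℝ)))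
        (g : Fin N → (Fin (m + 3) → ℝ) → ℝ) (U : Fin N → Set (Fin (m + 3) → ℝ)),
        (∀ i, IsSemialgebraicMapOn ℚ {z : Fin (m + 3) → ℝ | ∀ l, 0 < z l ∧ z l < 1} (Φ i) ∧
          (∀ x ∈ {z : Fin (m + 3) → ℝ | ∀ l, 0 < z l ∧ z l < 1},
            HasFDerivWithinAt (Φ i) (Φ' i x) {z : Fin (m + 3) → ℝ | ∀ l, 0 < z l ∧ z l < 1} x) ∧
          Set.InjOn (Φ i) {z : Fin (m + 3) → ℝ | ∀ l, 0 < z l ∧ z l < 1} ∧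
          Φ i '' {z : Fin (m + 3) → ℝ | ∀ l, 0 < z l ∧ z l < 1} ⊆ K.domain ∧
          IsOpen (U i) ∧ Set.pi Set.univ (fun _ : Fin (m + 3) => Set.Icc (0:ℝ) 1) ⊆ U i ∧
          IsSemialgebraicFunOn ℚ (U i) (g i) ∧ AnalyticOnNhd ℝ (g i) (U i) ∧
          (∀ x ∈ {z : Fin (m + 3) → ℝ | ∀ l, 0 < z l ∧ z l < 1}, |(Φ' i x).det| = g i x)) →
        (∀ i j, i ≠ j → Disjoint (Φ i '' {z : Fin (m + 3) → ℝ | ∀ l, 0 < z l ∧ z l < 1})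
          (Φ j '' {z : Fin (m + 3) → ℝ | ∀ l, 0 < z l ∧ z l < 1})) →
        volume (K.domain \ ⋃ i, Φ i '' {z : Fin (m + 3) → ℝ | ∀ l, 0 < z l ∧ z l < 1}) = 0 →
      ∃ (S : ℕ) (n : Fin S → ℕ) (g' : (i : Fin S) → (Fin (n i) → ℝ) → ℝ)
        (U' : (i : Fin S) → Set (Fin (n i) → ℝ)) (ε : Fin S → ℤ) (s : (i : Fin S) → IntegralRep (n i)),
        (∀ i, IsOpen (U' i) ∧ Set.pi Set.univ (fun _ : Fin (n i) => Set.Icc (0:ℝ) 1) ⊆ (U' i) ∧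
          IsSemialgebraicFunOn ℚ (U' i) (g' i) ∧ AnalyticOnNhd ℝ (g' i) (U' i)) ∧
        (∀ i, (s i).domain = Set.pi Set.univ (fun _ : Fin (n i) => Set.Icc (0:ℝ) 1) ∧
          ∀ z ∈ Set.pi Set.univ (fun _ : Fin (n i) => Set.Icc (0:ℝ) 1), (s i).integrand z = g' i z) ∧
        of K - ∑ i, ε i • of (s i) ∈ relations) →
    Summit.KontsevichZagierPeriods.KontsevichZagierPeriods.Theses.LiftingCriteria.CubeNashNormalForm := by
  intro h1 h2
  refine Summit.KontsevichZagierPeriods.LiftingCriteria.CubeNashNormalFormDimLeOne.cubeNashNormalForm_of_volume_three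
    fun m K hb hK1 => ?_
  obtain ⟨N, Φ, Φ', g, U, hcharts, hdisj, hnull⟩ := h1 m K.domain K.isSemialgebraic_domain hb
  exact h2 m K hb hK1 N Φ Φ' g U hcharts hdisj hnull

/-- **Registered composition** (the two stubs BY NAME): the shared crux `CubeNashNormalForm`
(stmt-KontsevichZagierPeriods-3574, home decl `LiftingCriteria.CubeNashNormalForm`; the DimensionBudget
route decl of the same item is definitionally equal) from `stub_tameCellAtlas` and
`stub_atlasToNormalForm` through the landed reduction. [Kontsevich–Zagier 2001, §1.2; Viu-Sos 2021, Thm. 1.1] -/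
theorem CubeNashNormalForm_of :
    Summit.KontsevichZagierPeriods.KontsevichZagierPeriods.Theses.LiftingCriteria.CubeNashNormalForm :=
  CubeNashNormalForm_of_stubs stub_tameCellAtlas stub_atlasToNormalForm

/-- The same conclusion for the DimensionBudget route decl of the shared item (rev 3 of that route file).
[Kontsevich–Zagier 2001, §1.2] -/
theorem CubeNashNormalForm_of' :
    Summit.KontsevichZagierPeriods.KontsevichZagierPeriods.Theses.DimensionBudget.CubeNashNormalForm :=
  CubeNashNormalForm_of

end Summit.KontsevichZagierPeriods.KontsevichZagierPeriods.Cruxes.CubeNashNormalForm.TameCellAtlas
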